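import Summits.AtomisticToContinuum.HydrodynamicLimit.Theorems.MourreKoopmanChargesOneBodyCompletenessTorusMoments
import Summits.AtomisticToContinuum.HydrodynamicLimit.Theorems.MourreKoopmanChargesOneBodyCompletenessWindowPassage
import Summits.AtomisticToContinuum.HydrodynamicLimit.Theorems.MourreKoopmanChargesOneBodyCompletenessGibbsOrthogonality
import Summits.AtomisticToContinuum.HydrodynamicLimit.Theorems.MourreKoopmanChargesOneBodyCompletenessReduction
import Summits.AtomisticToContinuum.HydrodynamicLimit.Theorems.MourreKoopmanChargesOneBodyCompletenessDiluteGibbsStateUnit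
import Summits.AtomisticToContinuum.HydrodynamicLimit.Theorems.MourreKoopmanChargesOneBodyCompletenessDensityClustering
import Summits.AtomisticToContinuum.HydrodynamicLimit.Theorems.MourreKoopmanChargesOneBodyCompletenessChargeClustering
import Summits.AtomisticToContinuum.HydrodynamicLimit.Theorems.MourreKoopmanChargesOneBodyCompletenessProfileClustering
import Summits.AtomisticToContinuum.HydrodynamicLimit.Theorems.MourreKoopmanChargesOneBodyCompletenessStrongContinuity
import Summits.AtomisticToContinuum.HydrodynamicLimit.Theorems.MourreKoopmanChargesOneBodyCompletenessDynamicClusteringReduction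
import Summits.AtomisticToContinuum.HydrodynamicLimit.Theorems.MourreKoopmanChargesOneBodyCompletenessFlowContinuityB
import Summits.AtomisticToContinuum.HydrodynamicLimit.Theorems.MourreKoopmanChargesOneBodyCompletenessIdentificationConjectures
import Summits.AtomisticToContinuum.HydrodynamicLimit.Theorems.MourreKoopmanChargesStressStrongMixingStressFramework
import Summits.AtomisticToContinuum.HydrodynamicLimit.Theorems.MourreKoopmanChargesStressStrongMixingObservableSpan
import Summits.AtomisticToContinuum.HydrodynamicLimit.Theorems.MourreKoopmanChargesStressStrongMixingFoelnerPositivity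
import Summits.AtomisticToContinuum.HydrodynamicLimit.Theorems.MourreKoopmanChargesStressStrongMixingGibbsMoments
import Summits.AtomisticToContinuum.HydrodynamicLimit.Theorems.MourreKoopmanChargesStressStrongMixingEquilibriumFlowShiftCovariant
import Literature.Analysis.FluidPDE.InfiniteHardSphereKoopman
import HarnessLib

/-!
# `OneBodyCompleteness` (crux stmt-AtomisticToContinuum-9583, route `MourreKoopmanCharges`), line `registered`:
# the v8 ASSEMBLY — the crux from Alexander's theorem, three named framework conjectures and `ChargesCompleteHS`

Support file (`--supports stmt-AtomisticToContinuum-9583`) recording, as theorems of the tree, the glue and the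
composition of skeleton v8 (`Cruxes/OneBodyCompleteness/Lines/birth.lean`, lead c3, 2026-08-17):
* `packaging_of_inputs` — PER-PROFILE DYNAMICAL PACKAGING of a dilute unit-diameter translation-invariant DLR state
  `G` (activity `≤ 2σ³`, `M_1` marks) as Spohn fluctuation data `F` (`F.μ = G`, Alexander flow a.e., strongly
  continuous Koopman group, `A_g ∈ 𝒱_F`) on the MINIMAL observable space `flowShiftSpan Φ (range cellCharge ∪
  {cellObs g})` for one continuous polynomially bounded profile `g ⊥ 1`, from Alexander's theorem
  `InfiniteHardSphereFlow.nonempty ∧ .unique` (named, unproved) and ONE open input, the continuous-clustering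
  conjecture D1 (Spohn 1991 Part I Condition 2.1 / Doyon 2022 Def. 4.8 for the six generators) — the static
  clustering of the generators (p162886, p163877, p164213), strong continuity from generators (p164309), mean-square
  flow continuity (p168987) and the reduction `dynamicClusteringOneBody_of` (p165274) being LANDED; assembly
  `Φ.fluctuationData ⟨G, flowShiftSpan Φ S_g, …⟩` with the sibling crux's span lemmas.
* `oneBodyCompleteness_of_inputs` — THE CRUX BY NAME from Alexander's theorem, D1, the identification conjectures
  I1 `TwoTimeLocalLimitUnit` / I2 `UniformTorusTwoTimeClustering` (p169946, through the landed
  `torusIdentificationUnit_of` p169750) and the route item `ChargesCompleteHS` (stmt-14141): the crux is CLOSED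
  MODULO one named theorem of the literature, three named framework conjectures (assumptions in print) and the
  route's own infinite-volume crux. CONDITIONAL (recorded as such); nothing is admitted.

References: H. Spohn, *Large Scale Dynamics of Interacting Particles* (1991), Part I §2.2, §7.1; B. Doyon, Comm.
Math. Phys. 391 (2022) §4; R. Alexander, Comm. Math. Phys. 49 (1976) Thm 5.2, Cor 5.4.
-/

noncomputable section

namespace Summit.AtomisticToContinuum.HydrodynamicLimit.Theorems.MourreKoopmanChargesOneBodyCompleteness

open scoped BigOperators Topology InnerProductSpace ENNReal
open Filter Set Function MeasureTheory ProbabilityTheory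
open Literature.MathematicalPhysics.KineticTheory Literature.Analysis.FluidPDE
open Summit.AtomisticToContinuum.HydrodynamicLimit.Theses.MourreKoopmanCharges
open Summit.AtomisticToContinuum.HydrodynamicLimit.Theorems.MourreKoopmanChargesStressStrongMixing
  (memLp_of_mem_flowShiftSpan integrable_cov_of_mem_flowShiftSpan integral_cov_spatialShift_nonneg
    memLp_two_cellObs_of_isHardSphereGibbs equilibriumFlowShiftCovariant_of_unique
    integral_cellCharge_zero_eq_toReal_density)

namespace Assembly

/-- Every element of the flow–shift span of measurable generators is measurable (minimality against the
submodule of measurable functions; flow maps and translations are measurable). [folklore] -/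
theorem measurable_of_mem_flowShiftSpan {ε : ℝ} (Φ : InfiniteHardSphereFlow (Fin 3) ε) {S : Set (MarkedConfig → ℝ)}
    (hS : ∀ a ∈ S, Measurable a) {f : MarkedConfig → ℝ} (hf : f ∈ flowShiftSpan Φ S) : Measurable f := by
  let W : Submodule ℝ (MarkedConfig → ℝ) :=
    { carrier := {g | Measurable g}
      zero_mem' := measurable_const
      add_mem' := fun hg hg' => Measurable.add hg hg'
      smul_mem' := fun c g hg => Measurable.const_smul (hg : Measurable g) c }
  have hle : flowShiftSpan Φ S ≤ W :=
    flowShiftSpan_le (fun a ha => hS a ha) (fun t g hg => (hg : Measurable g).comp (Φ.measurable_flow t))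
      (fun x g hg => (hg : Measurable g).comp (Literature.Analysis.FunctionSpaces.PointConfig.measurable_translate _))
  exact hle hf

/-- **Static clustering of all generator pairs** from the three landed static stubs: charge–charge pairs by
`stub_densityClustering` + `stub_chargeClusteringOfDensity` (at `β = 1`), pairs with `A_g` by
`stub_staticClusteringProfile`. [folklore] -/
theorem staticClustering_generators :
    ∃ z₃ : ℝ, 0 < z₃ ∧ ∀ z : ℝ, 0 < z → z < z₃ → ∀ G : Measure MarkedConfig, IsHardSphereGibbs 1 z 1 (0 : V3) G →
      IsTranslationInvariant G →
      ∀ g : V3 → ℝ, Continuous g → (∃ (C : ℝ) (k : ℕ), ∀ v, |g v| ≤ C * (1 + ‖v‖) ^ k) →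
        (∫ v, g v * localMaxwellian 1 1 (0 : V3) v = 0) →
        ∀ a ∈ Set.range cellCharge ∪ {cellObs g}, ∀ b ∈ Set.range cellCharge ∪ {cellObs g},
          Integrable (fun x : V3 => cov[a, b ∘ spatialShift x; G]) volume := by
  obtain ⟨z₃, hz₃, H⟩ := stub_densityClustering
  refine ⟨z₃, hz₃, fun z hz hzlt G hG hti g hg hb hg0 => ?_⟩
  rintro a ha b (⟨j, rfl⟩ | hb')
  · rcases ha with ⟨i, rfl⟩ | ha'
    · exact stub_chargeClusteringOfDensity z 1 hz one_pos G hG hti (H z 1 hz hzlt one_pos G hG hti) i j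
    · rw [Set.mem_singleton_iff.1 ha']
      exact (stub_staticClusteringProfile z hz G hG hti g hg hb hg0 (cellCharge j) (Or.inl ⟨j, rfl⟩)).2
  · rw [Set.mem_singleton_iff.1 hb']
    exact (stub_staticClusteringProfile z hz G hG hti g hg hb hg0 a ha).1

/-- **The minimal observable space is admissible**: for a unit-diameter equilibrium flow `Φ` commuting
with the shifts `G`-a.e., a translation-invariant DLR state `G` at unit inverse temperature, and a profile
`g` whose six generators are in `L²(G)` and cluster at every pair of times,
`IsLocalObservableSpace Φ G (flowShiftSpan Φ {n_i, A_g})` — `L²` and clustering by the landed span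
reductions, positivity of the structure factor by the landed Følner lemma. [folklore] -/
theorem isLocalObservableSpace_min {z : ℝ} (hz : 0 < z) {Φ : InfiniteHardSphereFlow (Fin 3) 1}
    (hΦ : Φ.IsEquilibriumFlow) {G : Measure MarkedConfig} (hG : IsHardSphereGibbs 1 z 1 (0 : V3) G)
    (hti : IsTranslationInvariant G)
    (hcomm : ∀ (t : ℝ) (x : V3), Φ.flow t ∘ spatialShift x =ᵐ[G] spatialShift x ∘ Φ.flow t)
    {g : V3 → ℝ} (hg : Continuous g)
    (hmom : ∀ a ∈ Set.range cellCharge ∪ {cellObs g}, MemLp a 2 G)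
    (hcl : ∀ a ∈ Set.range cellCharge ∪ {cellObs g}, ∀ b ∈ Set.range cellCharge ∪ {cellObs g}, ∀ t : ℝ,
      Integrable (fun x : V3 => cov[a, (b ∘ Φ.flow t) ∘ spatialShift x; G]) volume) :
    IsLocalObservableSpace Φ G (flowShiftSpan Φ (Set.range cellCharge ∪ {cellObs g})) := by
  obtain ⟨hD, hS⟩ := hΦ z 1 hz one_pos G hG
  haveI : IsProbabilityMeasure G := hG.1
  have hflow : ∀ t : ℝ, MeasurePreserving (Φ.flow t) G G := fun t => hS.measurePreserving t
  have hshift : ∀ x : V3, MeasurePreserving (spatialShift x) G G := fun x =>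
    ⟨Literature.Analysis.FunctionSpaces.PointConfig.measurable_translate _, hti x⟩
  have hzero : Φ.flow 0 =ᵐ[G] id := by
    filter_upwards [hD] with ω hω
    exact Φ.flow_zero ω hω
  have hadd : ∀ s t : ℝ, Φ.flow (s + t) =ᵐ[G] Φ.flow s ∘ Φ.flow t := fun s t => Φ.flow_add_ae hD hS s t
  have hch : ∀ i : Fin 5, cellCharge i ∈ flowShiftSpan Φ (Set.range cellCharge ∪ {cellObs g}) :=
    fun i => subset_flowShiftSpan (Or.inl ⟨i, rfl⟩)
  have hL2 : ∀ f ∈ flowShiftSpan Φ (Set.range cellCharge ∪ {cellObs g}), MemLp f 2 G :=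
    fun f hf => memLp_of_mem_flowShiftSpan Φ G hflow hshift hmom hf
  have hcov : ∀ f ∈ flowShiftSpan Φ (Set.range cellCharge ∪ {cellObs g}),
      ∀ f' ∈ flowShiftSpan Φ (Set.range cellCharge ∪ {cellObs g}),
        Integrable (fun x : V3 => cov[f, f' ∘ spatialShift x; G]) volume :=
    fun f hf f' hf' => integrable_cov_of_mem_flowShiftSpan Φ G hflow hshift hzero hadd hcomm hmom hcl hf hf'
  refine (isLocalObservableSpace_flowShiftSpan_iff hch).2 ⟨fun f hf => hL2 f hf, fun f hf f' hf' => hcov f hf f' hf', ?_⟩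
  intro f hf
  exact integral_cov_spatialShift_nonneg G hG.1 hshift f
    (measurable_of_mem_flowShiftSpan Φ (DynamicClustering.measurable_of_mem_oneBodyGenerators hg) hf) (hL2 f hf) (hcov f hf f hf)

/-- **Per-profile dynamical packaging at fixed parameters** (assembly): the datum
`F := Φ.fluctuationData ⟨G, flowShiftSpan Φ {n_i, A_g}, …⟩` has state `G` (definitionally), is carried by
`Φ`, contains `A_g`, and — by the landed `stub_strongContinuityOfGenerators` (p164309) with dynamical continuity
of the six generators — has a strongly continuous Koopman group. [folklore] -/
theorem exists_packaging_min {z : ℝ} (hz : 0 < z) {Φ : InfiniteHardSphereFlow (Fin 3) 1}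
    (hΦ : Φ.IsEquilibriumFlow) {G : Measure MarkedConfig} (hG : IsHardSphereGibbs 1 z 1 (0 : V3) G)
    (hti : IsTranslationInvariant G)
    (hcomm : ∀ (t : ℝ) (x : V3), Φ.flow t ∘ spatialShift x =ᵐ[G] spatialShift x ∘ Φ.flow t)
    {g : V3 → ℝ} (h𝒱 : IsLocalObservableSpace Φ G (flowShiftSpan Φ (Set.range cellCharge ∪ {cellObs g})))
    (hdc : ∀ b ∈ Set.range cellCharge ∪ {cellObs g},
      ContinuousAt (fun t : ℝ => ∫ x : V3, cov[b, (b ∘ Φ.flow t) ∘ spatialShift x; G]) 0) :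
    ∃ F : HardSphereFluctuationData 1,
      F.μ = G ∧
      (∃ Φ : InfiniteHardSphereFlow (Fin 3) 1, Φ.IsEquilibriumFlow ∧ ∀ t : ℝ, F.flow t =ᵐ[F.μ] Φ.flow t) ∧
      (∀ ψ : HardSphereFluctuationSpace F, Continuous fun t : ℝ => F.koopman t ψ) ∧
      cellObs g ∈ F.localObs := by
  let St : FluctuationStructure (volume : Measure V3) spatialShift :=
    { μ := G
      isProbabilityMeasure := hG.1
      measurePreserving_shift := fun x => ⟨Literature.Analysis.FunctionSpaces.PointConfig.measurable_translate _, hti x⟩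
      localObs := flowShiftSpan Φ (Set.range cellCharge ∪ {cellObs g})
      memLp_of_mem := h𝒱.memLp
      comp_shift_mem := h𝒱.comp_shift_mem
      integrable_cov := h𝒱.integrable_cov
      form_self_nonneg := h𝒱.form_self_nonneg }
  have hP : Φ.IsAEDefined St.μ := hΦ.isAEDefined hz one_pos hG
  have hS : Φ.IsStationary St.μ := hΦ.isStationary hz one_pos hG
  refine ⟨Φ.fluctuationData St hP hS hcomm h𝒱.comp_flow_mem h𝒱.cellCharge_mem, rfl,
    ⟨Φ, hΦ, fun t => Filter.EventuallyEq.rfl⟩, ?_, subset_flowShiftSpan (Or.inr rfl)⟩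
  exact stub_strongContinuityOfGenerators 1 (Φ.fluctuationData St hP hS hcomm h𝒱.comp_flow_mem h𝒱.cellCharge_mem) Φ
    (Set.range cellCharge ∪ {cellObs g}) (fun t => rfl) rfl hdc

end Assembly

open Assembly

/-- **PER-PROFILE DYNAMICAL PACKAGING from Alexander's theorem and the continuous-clustering conjecture D1**
(everything else LANDED: static clustering p162886/p163877/p164213, strong continuity p164309, mean-square flow
continuity p168987, reduction p165274; the v6–v8 replacement of the v5 stub `stub_fluctuationPackagingUnit`): below `σ₃ := min 1 (min z₃ z₄ / 2)`, every translation-invariant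
DLR state `G` of unit hard spheres with `M_1` marks, activity `0 < z ≤ 2σ³` and density `σ³` is, for each
continuous polynomially bounded profile `g ⊥ 1`, the state of some `F : HardSphereFluctuationData 1`
carried by Alexander's flow, with strongly continuous Koopman group and `A_g ∈ 𝒱_F`
(`𝒱_F = flowShiftSpan Φ {n_i, A_g}`; Alexander's flow from `stub_alexanderFlow.1`, a.e. shift
commutation from `.2` by `equilibriumFlowShiftCovariant_of_unique`). [folklore] -/
theorem packaging_of_inputs
    (hAlex : InfiniteHardSphereFlow.nonempty (d := Fin 3) ∧ InfiniteHardSphereFlow.unique (d := Fin 3))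
    (hD1 : ∃ z₄ : ℝ, 0 < z₄ ∧ ∀ Φ : InfiniteHardSphereFlow (Fin 3) 1, Φ.IsEquilibriumFlow →
      ∀ z : ℝ, 0 < z → z < z₄ → ∀ G : Measure MarkedConfig, IsHardSphereGibbs 1 z 1 (0 : V3) G →
        IsTranslationInvariant G →
        ∀ g : V3 → ℝ, Continuous g → (∃ (C : ℝ) (k : ℕ), ∀ v, |g v| ≤ C * (1 + ‖v‖) ^ k) →
          (∫ v, g v * localMaxwellian 1 1 (0 : V3) v = 0) →
          (∀ a ∈ Set.range cellCharge ∪ {cellObs g}, ∀ b ∈ Set.range cellCharge ∪ {cellObs g},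
              Integrable (fun x : V3 => cov[a, b ∘ spatialShift x; G]) volume) →
          ∀ a ∈ Set.range cellCharge ∪ {cellObs g}, ∀ b ∈ Set.range cellCharge ∪ {cellObs g}, ∀ T : ℝ,
            ∃ F : V3 → ℝ, Integrable F volume ∧ ∃ R : ℝ, ∀ t : ℝ, |t| ≤ T →
              ∀ x : V3, R ≤ ‖x‖ → |cov[a, (b ∘ Φ.flow t) ∘ spatialShift x; G]| ≤ F x) :
    ∃ σ₃ : ℝ, 0 < σ₃ ∧ ∀ σ : ℝ, 0 < σ → σ < σ₃ → ∀ z : ℝ, 0 < z → z ≤ 2 * σ ^ 3 →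
      ∀ G : Measure MarkedConfig, IsHardSphereGibbs 1 z 1 (0 : V3) G → IsTranslationInvariant G →
        PointProcess.density G = ENNReal.ofReal (σ ^ 3) →
        ∀ g : V3 → ℝ, Continuous g → (∃ (C : ℝ) (k : ℕ), ∀ v, |g v| ≤ C * (1 + ‖v‖) ^ k) →
          (∫ v, g v * localMaxwellian 1 1 (0 : V3) v = 0) →
          ∃ F : HardSphereFluctuationData 1,
            F.μ = G ∧
            (∃ Φ : InfiniteHardSphereFlow (Fin 3) 1, Φ.IsEquilibriumFlow ∧ ∀ t : ℝ, F.flow t =ᵐ[F.μ] Φ.flow t) ∧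
            (∀ ψ : HardSphereFluctuationSpace F, Continuous fun t : ℝ => F.koopman t ψ) ∧
            cellObs g ∈ F.localObs := by
  obtain ⟨z₃, hz₃, Hst⟩ := staticClustering_generators
  obtain ⟨z₄, hz₄, Hdyn⟩ := dynamicClusteringOneBody_of hD1 stub_flowMeanSquareContinuity
  obtain ⟨Φ, hΦ⟩ := hAlex.1 (zero_lt_one' ℝ)
  have hm : 0 < min z₃ z₄ / 2 := half_pos (lt_min hz₃ hz₄)
  refine ⟨min 1 (min z₃ z₄ / 2), lt_min one_pos hm, ?_⟩
  intro σ hσ hσlt z hz hzle G hG hti _hρ g hg hb hg0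
  have hσ1 : σ < 1 := lt_of_lt_of_le hσlt (min_le_left _ _)
  have hσm : σ < min z₃ z₄ / 2 := lt_of_lt_of_le hσlt (min_le_right _ _)
  have hσ3le : σ ^ 3 ≤ σ := by
    calc σ ^ 3 = σ * (σ * σ) := by ring
      _ ≤ σ * (1 * 1) := by gcongr
      _ = σ := by ring
  have hzlt : z < min z₃ z₄ := by linarith
  have hz3 : z < z₃ := lt_of_lt_of_le hzlt (min_le_left _ _)
  have hz4 : z < z₄ := lt_of_lt_of_le hzlt (min_le_right _ _)
  -- a.e. shift commutation of the equilibrium flow (Alexander uniqueness)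
  have hcomm : ∀ (t : ℝ) (x : V3), Φ.flow t ∘ spatialShift x =ᵐ[G] spatialShift x ∘ Φ.flow t :=
    fun t x => equilibriumFlowShiftCovariant_of_unique hAlex.2 1 one_pos Φ hΦ z 1 hz one_pos G hG t x
  -- static clustering of the six generators, then the dynamic upgrade + dynamical continuity
  have hst := Hst z hz hz3 G hG hti g hg hb hg0
  obtain ⟨hcl, hdc⟩ := Hdyn Φ hΦ z hz hz4 G hG hti g hg hb hg0 hst
  have h𝒱 := isLocalObservableSpace_min hz hΦ hG hti hcomm hg (DynamicClustering.memLp_of_mem_oneBodyGenerators hz hG hg hb) hcl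
  exact exists_packaging_min hz hΦ hG hti hcomm h𝒱 hdc

/-- **THE CRUX FROM ITS NAMED INPUTS** (kernel-checked, axiom-clean, nothing admitted; CONDITIONAL): Alexander's
theorem (`InfiniteHardSphereFlow.nonempty ∧ .unique`, named, unproved), the continuous-clustering conjecture D1
for the six generators (Spohn 1991 Part I Condition 2.1 / Doyon 2022 Def. 4.8), the identification conjectures
I1 `TwoTimeLocalLimitUnit` and I2 `UniformTorusTwoTimeClustering` (p169946) and the route item
`ChargesCompleteHS` (stmt-14141, at `σ = β = 1`) imply the crux `MourreKoopmanCharges.OneBodyCompleteness` BY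
NAME — every other piece of the line is LANDED. Proof as in the skeleton: package the dilute state for
`h_θ := h(√θ ·)`; `[A_{h_θ}] ⊥ 𝒬₀ ⊆ 𝒞`; mean ergodic theorem; identification; torus moments; window passage. [folklore] -/
theorem oneBodyCompleteness_of_inputs
    (hAlex : InfiniteHardSphereFlow.nonempty (d := Fin 3) ∧ InfiniteHardSphereFlow.unique (d := Fin 3))
    (hD1 : (∃ z₄ : ℝ, 0 < z₄ ∧ ∀ Φ : InfiniteHardSphereFlow (Fin 3) 1, Φ.IsEquilibriumFlow →
      ∀ z : ℝ, 0 < z → z < z₄ → ∀ G : Measure MarkedConfig, IsHardSphereGibbs 1 z 1 (0 : V3) G →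
        IsTranslationInvariant G →
        ∀ g : V3 → ℝ, Continuous g → (∃ (C : ℝ) (k : ℕ), ∀ v, |g v| ≤ C * (1 + ‖v‖) ^ k) →
          (∫ v, g v * localMaxwellian 1 1 (0 : V3) v = 0) →
          (∀ a ∈ Set.range cellCharge ∪ {cellObs g}, ∀ b ∈ Set.range cellCharge ∪ {cellObs g},
              Integrable (fun x : V3 => cov[a, b ∘ spatialShift x; G]) volume) →
          ∀ a ∈ Set.range cellCharge ∪ {cellObs g}, ∀ b ∈ Set.range cellCharge ∪ {cellObs g}, ∀ T : ℝ,
            ∃ F : V3 → ℝ, Integrable F volume ∧ ∃ R : ℝ, ∀ t : ℝ, |t| ≤ T →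
              ∀ x : V3, R ≤ ‖x‖ → |cov[a, (b ∘ Φ.flow t) ∘ spatialShift x; G]| ≤ F x))
    (hI1 : TwoTimeLocalLimitUnit) (hI2 : UniformTorusTwoTimeClustering)
    (h3 : ChargesCompleteHS) :
    OneBodyCompleteness := by
  -- the identification from I1, I2 by the landed reduction (p169750/p169946)
  have h2 := torusIdentificationUnit_of_conjectures hI1 hI2
  obtain ⟨z₀, hz₀, hcomplete⟩ := h3 1 one_pos 1 one_pos
  obtain ⟨z₂, hz₂, hident⟩ := h2
  obtain ⟨σ₁, hσ₁, hstate⟩ := stub_diluteGibbsStateUnit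
  obtain ⟨σ₃, hσ₃, hpack⟩ := packaging_of_inputs hAlex hD1
  have hm : 0 < min z₀ z₂ / 2 := half_pos (lt_min hz₀ hz₂)
  refine ⟨min (min σ₁ σ₃) (min (1 / 2) (min z₀ z₂ / 2)),
    lt_min (lt_min hσ₁ hσ₃) (lt_min one_half_pos hm), ?_⟩
  intro σ hσ hσlt θ hθ h hh hbound hm0 hm1 hm2 Φ χ hχ δ hδ
  have hσ1 : σ < σ₁ := lt_of_lt_of_le hσlt ((min_le_left _ _).trans (min_le_left _ _))
  have hσ3 : σ < σ₃ := lt_of_lt_of_le hσlt ((min_le_left _ _).trans (min_le_right _ _))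
  have hσhalf : σ < 1 / 2 := lt_of_lt_of_le hσlt ((min_le_right _ _).trans (min_le_left _ _))
  have hσm : σ < min z₀ z₂ / 2 := lt_of_lt_of_le hσlt ((min_le_right _ _).trans (min_le_right _ _))
  -- the dilute Gibbs state of density σ³
  obtain ⟨z, G, hz, hzle, hGibbsG, hti, hρ⟩ := hstate σ hσ hσ1
  -- the rescaled profile h_θ = h (√θ ·)
  have hhθ : Continuous fun w : V3 => h (Real.sqrt θ • w) := hh.comp (continuous_const_smul (Real.sqrt θ))
  have hboundθ := poly_bound_comp_sqrt (θ := θ) hbound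
  obtain ⟨hm0', hm1', hm2'⟩ := orthogonal_comp_sqrt hθ hm0 hm1 hm2
  -- its dynamical packaging
  obtain ⟨F, hFμ, hflow, hcont, hmem⟩ :=
    hpack σ hσ hσ3 z hz hzle G hGibbsG hti hρ (fun w => h (Real.sqrt θ • w)) hhθ hboundθ hm0'
  have hGibbs : IsHardSphereGibbs 1 z 1 (0 : V3) F.μ := by rw [hFμ]; exact hGibbsG
  -- activity below both thresholds: z ≤ 2σ³ ≤ 2σ < min z₀ z₂
  have hσ3le : σ ^ 3 ≤ σ := by
    calc σ ^ 3 = σ * (σ * σ) := by ring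
      _ ≤ σ * (1 * 1) := by gcongr <;> linarith
      _ = σ := by ring
  have hzlt : z < min z₀ z₂ := by linarith
  have hz0 : z < z₀ := lt_of_lt_of_le hzlt (min_le_left _ _)
  have hz2 : z < z₂ := lt_of_lt_of_le hzlt (min_le_right _ _)
  -- density one-body charge: ∫ n = σ³ (hard core a.e. from the a.e.-defined Alexander flow)
  have hcore : ∀ᵐ ω ∂F.μ, IsHardCore 1 ω := by
    obtain ⟨Ψ, hΨ, -⟩ := hflow
    exact Ψ.isHardCore_ae (hΨ z 1 hz one_pos F.μ hGibbs).1
  have hdens : ∫ ω, cellCharge 0 ω ∂F.μ = σ ^ 3 := by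
    rw [integral_cellCharge_zero_eq_toReal_density one_pos hcore, hFμ, hρ, ENNReal.toReal_ofReal (by positivity)]
  -- Maxwellian orthogonality in ℋ_F from the DLR computation (landed `gibbsMaxwellianOrthogonality`)
  have hGibbs' : IsHardSphereGibbs 1 z (1 : ℝ)⁻¹ (0 : V3) F.μ := by rw [inv_one]; exact hGibbs
  have horth' : ∀ i : Fin 5, ⟪F.fluct (cellObs fun w => h (Real.sqrt θ • w)), F.chargeClass i⟫_ℝ = 0 := by
    intro i
    rw [HardSphereFluctuationData.chargeClass_def, FluctuationStructure.inner_fluct_fluct hmem (F.cellCharge_mem i),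
      FluctuationStructure.form_def]
    simp only [gibbsMaxwellianOrthogonality 1 z 1 one_pos hz one_pos F.μ hGibbs' _ hhθ hboundθ hm0' hm1' hm2' i,
      integral_zero]
  -- charges are complete for the framework data (route item ChargesCompleteHS at σ = β = 1)
  have hcc : F.ChargesComplete := hcomplete z hz hz0 F hGibbs hflow
  -- ψ = [A_{h_θ}] is orthogonal to the conserved space 𝒬₀ ⊆ 𝒞 = span (q_i)
  set ψ := F.fluct (cellObs fun w => h (Real.sqrt θ • w)) with hψdef
  have hperp : ∀ φ ∈ F.conservedSpace, ⟪ψ, φ⟫_ℝ = 0 := by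
    intro φ hφ
    have hφ' : φ ∈ Submodule.span ℝ (Set.range F.chargeClass) := hcc hφ
    obtain ⟨a, rfl⟩ := (Submodule.mem_span_range_iff_exists_fun ℝ).1 hφ'
    rw [inner_sum]
    refine Finset.sum_eq_zero fun i _ => ?_
    rw [real_inner_smul_right, horth' i, mul_zero]
  -- mean ergodic theorem: Cesàro decay of ⟪U_u ψ, ψ⟫, then of the time-rescaled version
  have hκ : 0 < Real.sqrt θ / σ := div_pos (Real.sqrt_pos.2 hθ) hσ
  have hME := meanErgodic 1 F hcont ψ hperp
  have hMEκ := tendsto_cesaro_comp_mul (φ := fun u => ⟪F.koopman u ψ, ψ⟫_ℝ) hκ hME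
  -- identification constant and pointwise convergence of (N+1)·cov
  obtain ⟨K, hK⟩ := hident σ hσ hσhalf z hz hz2 θ hθ F hGibbs hflow hdens h hh hbound hmem hm0 hm1 hm2
  have hcov := fun s : ℝ => hK Φ χ hχ s
  -- continuity of the limit profile g(s) = (∫χ²) K ⟪U_{κ s} ψ, ψ⟫
  have hgc : Continuous fun s : ℝ => (∫ x, χ x * χ x) * K * ⟪F.koopman (Real.sqrt θ / σ * s) ψ, ψ⟫_ℝ :=
    continuous_const.mul (((hcont ψ).comp (continuous_const.mul continuous_id)).inner continuous_const)
  -- torus moments: cov = raw two-time moment, and domination by the equal-time moment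
  have hmom := fun (N : ℕ) (t : ℝ) => stub_torusMoments σ hσ hσhalf θ hθ h hh hbound hm0 N (Φ N) χ hχ t
  -- pointwise convergence of the raw moments
  have hraw : ∀ s : ℝ, Tendsto (fun N : ℕ => ((N : ℝ) + 1) *
      ∫ z, (∫ y, χ y.1 * h y.2 ∂(empiricalMeasure ((Φ N).flow (s * ((N : ℝ) + 1) ^ (-(1 / 3 : ℝ))) z))) *
        (∫ y, χ y.1 * h y.2 ∂(empiricalMeasure z))
        ∂(localGibbsLaw σ (fun _ => 1) (fun _ => 0) (fun _ => θ) N (Φ N))) atTop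
      (𝓝 ((∫ x, χ x * χ x) * K * ⟪F.koopman (Real.sqrt θ / σ * s) ψ, ψ⟫_ℝ)) := by
    intro s
    refine (hcov s).congr fun N => ?_
    rw [(hmom N (s * ((N : ℝ) + 1) ^ (-(1 / 3 : ℝ)))).1]
  -- the equal-time moments converge, hence are bounded
  have hraw0 : Tendsto (fun N : ℕ => ((N : ℝ) + 1) *
      ∫ z, (∫ y, χ y.1 * h y.2 ∂(empiricalMeasure ((Φ N).flow 0 z))) * (∫ y, χ y.1 * h y.2 ∂(empiricalMeasure z))
        ∂(localGibbsLaw σ (fun _ => 1) (fun _ => 0) (fun _ => θ) N (Φ N))) atTop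
      (𝓝 ((∫ x, χ x * χ x) * K * ⟪F.koopman (Real.sqrt θ / σ * 0) ψ, ψ⟫_ℝ)) := by
    have h0 := hraw 0
    simp only [zero_mul, mul_zero] at h0 ⊢
    exact h0
  obtain ⟨M, hM⟩ := exists_forall_le_of_tendsto hraw0
  -- uniform domination of the raw moments
  have hbd : ∀ (N : ℕ) (s : ℝ), |((N : ℝ) + 1) *
      ∫ z, (∫ y, χ y.1 * h y.2 ∂(empiricalMeasure ((Φ N).flow (s * ((N : ℝ) + 1) ^ (-(1 / 3 : ℝ))) z))) *
        (∫ y, χ y.1 * h y.2 ∂(empiricalMeasure z))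
        ∂(localGibbsLaw σ (fun _ => 1) (fun _ => 0) (fun _ => θ) N (Φ N))| ≤ M := by
    intro N s
    have hN : (0 : ℝ) ≤ (N : ℝ) + 1 := by positivity
    have hdom := (hmom N (s * ((N : ℝ) + 1) ^ (-(1 / 3 : ℝ)))).2
    rw [abs_mul, abs_of_nonneg hN]
    exact (mul_le_mul_of_nonneg_left hdom hN).trans (hM N)
  -- the limiting window averages tend to zero (mean ergodic theorem, rescaled time)
  have hL : Tendsto (fun S : ℝ => S⁻¹ * ∫ s in (0 : ℝ)..S, (∫ x, χ x * χ x) * K *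
      ⟪F.koopman (Real.sqrt θ / σ * s) ψ, ψ⟫_ℝ) atTop (𝓝 0) := by
    have e : (fun S : ℝ => S⁻¹ * ∫ s in (0 : ℝ)..S, (∫ x, χ x * χ x) * K *
        ⟪F.koopman (Real.sqrt θ / σ * s) ψ, ψ⟫_ℝ) =
        fun S : ℝ => (∫ x, χ x * χ x) * K * (S⁻¹ * ∫ s in (0 : ℝ)..S, ⟪F.koopman (Real.sqrt θ / σ * s) ψ, ψ⟫_ℝ) := by
      funext S
      rw [intervalIntegral.integral_const_mul]
      ring
    rw [e]
    simpa using hMEκ.const_mul ((∫ x, χ x * χ x) * K)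
  -- choose the window threshold S₀
  obtain ⟨S₁, hS₁⟩ := Metric.tendsto_atTop.1 hL (δ / 2) (half_pos hδ)
  refine ⟨max S₁ 1, lt_of_lt_of_le one_pos (le_max_right _ _), ?_⟩
  intro S hS
  have hSpos : 0 < S := lt_of_lt_of_le one_pos ((le_max_right _ _).trans hS)
  have hLS := hS₁ S ((le_max_left _ _).trans hS)
  rw [Real.dist_eq, sub_zero] at hLS
  -- window passage on the torus: eventually in N
  have hW := stub_windowPassage (fun (N : ℕ) (s : ℝ) => ((N : ℝ) + 1) *
      ∫ z, (∫ y, χ y.1 * h y.2 ∂(empiricalMeasure ((Φ N).flow (s * ((N : ℝ) + 1) ^ (-(1 / 3 : ℝ))) z))) *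
        (∫ y, χ y.1 * h y.2 ∂(empiricalMeasure z))
        ∂(localGibbsLaw σ (fun _ => 1) (fun _ => 0) (fun _ => θ) N (Φ N)))
    (fun s : ℝ => (∫ x, χ x * χ x) * K * ⟪F.koopman (Real.sqrt θ / σ * s) ψ, ψ⟫_ℝ)
    M hgc hbd hraw S hSpos (δ / 2) (half_pos hδ)
  obtain ⟨N₀, hN₀⟩ := eventually_atTop.1 hW
  refine ⟨N₀, fun N hN => ?_⟩
  have hNS := hN₀ N hN
  linarith [hNS, hLS]


end Summit.AtomisticToContinuum.HydrodynamicLimit.Theorems.MourreKoopmanChargesOneBodyCompleteness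

end
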